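import Summits.RiemannHypothesis.RiemannHypothesis.Theorems.JensenLogBandArcWindowZeta
import Summits.RiemannHypothesis.RiemannHypothesis.Theorems.JensenLogBandArcDescentR2Flank
import Summits.RiemannHypothesis.RiemannHypothesis.Theorems.JensenLogBandArcFlankStrip
import Literature.NumberTheory.LFunctions.Zhang2022.Section7ZetaNearOne
import Mathlib.Analysis.SpecialFunctions.Trigonometric.Bounds
import HarnessLib

/-!
# The right half-arc transform on the saddle circle: window + flanks (BAND line, step S5-2b)

RH ladder column JENSEN, rung J-P(P3) «log band», BAND crux `XiDerivBandRealAllRates` of route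
«JensenLogBand», line «band-one-window» (u-arc, top-shell reshape), lead rh-jensen-prover g8 — the
assembly step (S5-2b): the WHOLE right half-arc integral of the TRUE integrand on the circle of radius
`r = ‖u* − c‖` through the saddle `u*`, against its Laplace main term
`I(φ₀)·(π/w)^{1/2}·ζ(½+u*)`. RH-FREE (regime R2, `h ≤ 20`). WHAT THIS IS NOT: nothing here bears on
zeros of `ζ` off the line or the truth of RH.

Decomposition `[−π/2, π/2] = [−π/2, φ₀−ψ₁] ∪ [φ₀−ψ₁, φ₀+ψ₁] ∪ [φ₀+ψ₁, π/2]`: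
* window: `LogBandArc.window_zeta_term` (S5-2a, p497941);
* flank points with abscissa `½ + x + r cos θ > 1 + δ`: sharp R2 descent F6c
  (`LogBandArc.norm_arcModelIntegrand_le_descent_R2_sub`, eng-2 g6 p498111) × `‖ζ‖ ≤ 1 + 1/δ`
  (tree `Zhang2022.ZetaNearOne.norm_riemannZeta_le_of_re`);
* flank points inside the strip (`≤ 1 + δ`): `LogBandArc.norm_arcIntegrandU_saddleArc_le_of_re_le`
  (eng-2 g6 [FL-strip], p499041) — the strip majorant F2 against `γ̃` at the saddle.

`arc_integral_saddleCircle_estimate`: with `W` the window bracket of S5-1 and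
`F = e^{12h+6}(1+1/δ)e^{−(n+1)(1−cos ψ₁)} + 672·log(T+r)·e^{2h+1}·e^{−(σ*−1−δ)(ℓ/2−1)}`,

  `‖∫_{−π/2}^{π/2} arcIntegrandU n r c θ dθ − I(φ₀)(π/w)^{1/2}ζ(½+u*)‖ ≤ ‖I(φ₀)‖·(‖ζ(½+u*)‖·W + π·F)`.
-/

noncomputable section

-- single-problem summit: `Summit.RiemannHypothesis.RiemannHypothesis.…` is the tree convention
set_option linter.dupNamespace false

open Complex Real Set MeasureTheory intervalIntegral

namespace Summit.RiemannHypothesis.RiemannHypothesis.Theorems.JensenPolynomials.LogBandArc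

open Literature.NumberTheory.LFunctions

variable {n : ℕ} {x T : ℝ} {ustar : ℂ}

/-- **The saddle angle is at most `1` in modulus** (`|Im(u*−c)| ≤ 0.42·Re(u*−c)` ⇒
`cos φ₀ ≥ 1/1.42 > 2/3 ≥ cos 1`). [folklore] -/
theorem abs_saddle_arg_le_one (hx : |x| ≤ 1 / 2) (hT : 100 ≤ T) (hℓ : 20 ≤ ell T)
    (hn : 100 ≤ n) (hh : 1 / 2 ≤ bandRadius n T) (hhT : bandRadius n T ≤ 7 / 20 * T)
    (hustar : ‖ustar - ((x : ℂ) + (T : ℂ) * I + bandRadius n T)‖ ≤ 3 / 5 * bandRadius n T)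
    (hS : arcSaddleFn n ((x : ℂ) + (T : ℂ) * I) ustar = 0) :
    |Complex.arg (ustar - ((x : ℂ) + (T : ℂ) * I))| ≤ 1 := by
  set w : ℂ := ustar - ((x : ℂ) + (T : ℂ) * I) with hw
  obtain ⟨hre_pos, him1, him2, -, -⟩ := arcSaddle_polar_bounds hx hT hℓ hn hh hhT hustar hS
  rw [← hw] at hre_pos him1 him2
  have hw0 : w ≠ 0 := by
    intro h0; rw [h0] at hre_pos; simp at hre_pos
  have hℓinv : 2 / ell T ≤ 1 / 10 := by
    rw [div_le_iff₀ (by linarith)]; linarith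
  have him_abs : |w.im| ≤ 21 / 50 * w.re := by
    rw [abs_le]; constructor <;> nlinarith
  -- `‖w‖ ≤ re + |im| ≤ 1.42 re`
  have hnorm_le : ‖w‖ ≤ 71 / 50 * w.re := by
    have h1 := Complex.norm_le_abs_re_add_abs_im w
    rw [abs_of_pos hre_pos] at h1
    linarith
  have hnorm_pos : 0 < ‖w‖ := norm_pos_iff.2 hw0
  have hcos : 50 / 71 ≤ Real.cos (Complex.arg w) := by
    rw [Complex.cos_arg hw0, le_div_iff₀ hnorm_pos]
    linarith
  -- if `|arg w| > 1` then `cos (arg w) < cos 1 ≤ 2/3`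
  by_contra hcon
  push Not at hcon
  have hpi : |Complex.arg w| ≤ Real.pi := Complex.abs_arg_le_pi w
  have hlt : Real.cos |Complex.arg w| < Real.cos 1 :=
    Real.cos_lt_cos_of_nonneg_of_le_pi (by norm_num) hpi hcon
  rw [Real.cos_abs] at hlt
  have h23 : Real.cos 1 ≤ 5 / 9 := Real.cos_one_le
  linarith

/-- **Pointwise flank bound (both cases).** On the saddle circle, at an angle `θ` with `|θ| ≤ π/2`
and `ψ₁ ≤ |θ − φ₀|`: `‖arcIntegrandU n r c θ‖ ≤ ‖I(φ₀)‖·F` with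
`F = e^{12h+6}(1+1/δ)e^{−(n+1)(1−cos ψ₁)} + 672·log(T+r)·e^{2h+1}·e^{−(σ*−1−δ)(ℓ/2−1)}`
(arc point right of `1+δ`: F6c descent × `‖ζ‖ ≤ 1+1/δ`; inside the strip: [FL-strip]). [folklore] -/
theorem norm_arcIntegrandU_flank_le (hx : |x| ≤ 1 / 2) (hT : 100 ≤ T) (hℓ : 20 ≤ ell T)
    (hn : 100 ≤ n) (hh : 1 / 2 ≤ bandRadius n T) (hhT : bandRadius n T ≤ 7 / 20 * T)
    (hH : bandRadius n T ≤ 20)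
    (hustar : ‖ustar - ((x : ℂ) + (T : ℂ) * I + bandRadius n T)‖ ≤ 3 / 5 * bandRadius n T)
    (hS : arcSaddleFn n ((x : ℂ) + (T : ℂ) * I) ustar = 0) {δ ψ₁ : ℝ} (hδ : 0 < δ) (hδ1 : δ ≤ 1)
    (hδσ : 1 + δ ≤ (1 / 2 + ustar).re) (hψ₁ : 0 ≤ ψ₁) {θ : ℝ} (hθ : |θ| ≤ Real.pi / 2)
    (hflank : ψ₁ ≤ |θ - Complex.arg (ustar - ((x : ℂ) + (T : ℂ) * I))|) :
    ‖arcIntegrandU n ‖ustar - ((x : ℂ) + (T : ℂ) * I)‖ ((x : ℂ) + (T : ℂ) * I) θ‖ ≤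
      ‖arcModelIntegrand n ‖ustar - ((x : ℂ) + (T : ℂ) * I)‖ ((x : ℂ) + (T : ℂ) * I)
          (Complex.arg (ustar - ((x : ℂ) + (T : ℂ) * I)))‖ *
        (Real.exp (12 * bandRadius n T + 6) * (1 + 1 / δ) *
            Real.exp (-(((n : ℝ) + 1) * (1 - Real.cos ψ₁))) +
          672 * Real.log (T + ‖ustar - ((x : ℂ) + (T : ℂ) * I)‖) *
            Real.exp (2 * bandRadius n T + 1) *
            Real.exp (-(((1 / 2 + ustar).re - (1 + δ)) * (ell T / 2 - 1)))) := by
  set c : ℂ := (x : ℂ) + (T : ℂ) * I with hc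
  set w : ℂ := ustar - c with hw
  set r : ℝ := ‖w‖ with hr
  set φ₀ : ℝ := Complex.arg w with hφ₀
  have hT0 : 0 < T := by linarith
  obtain ⟨hre_pos, -, -, -, -⟩ := arcSaddle_polar_bounds hx hT hℓ hn hh hhT hustar hS
  rw [← hw] at hre_pos
  have hw0 : w ≠ 0 := by
    intro h0; rw [h0] at hre_pos; simp at hre_pos
  have hr0 : 0 < r := norm_pos_iff.2 hw0
  -- the two nonnegative bounds
  set A : ℝ := Real.exp (12 * bandRadius n T + 6) * (1 + 1 / δ) *
    Real.exp (-(((n : ℝ) + 1) * (1 - Real.cos ψ₁))) with hA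
  set B : ℝ := 672 * Real.log (T + r) * Real.exp (2 * bandRadius n T + 1) *
    Real.exp (-(((1 / 2 + ustar).re - (1 + δ)) * (ell T / 2 - 1))) with hB
  have hA0 : 0 ≤ A := by
    have : 0 ≤ 1 + 1 / δ := by have := one_div_pos.2 hδ; linarith
    positivity
  have hlog0 : 0 ≤ Real.log (T + r) := Real.log_nonneg (by linarith)
  have hB0 : 0 ≤ B := by positivity
  have hI0 : 0 ≤ ‖arcModelIntegrand n r c φ₀‖ := norm_nonneg _
  -- the abscissa of the arc point
  rcases le_or_gt (1 / 2 + x + r * Real.cos θ) (1 + δ) with hleft | hright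
  · -- inside the strip: [FL-strip]
    have h1 := norm_arcIntegrandU_saddleArc_le_of_re_le hx hT hℓ hn hh hhT hH hustar hS hδ hδ1
      hδσ hθ hleft
    calc ‖arcIntegrandU n r c θ‖ ≤ B * ‖arcModelIntegrand n r c φ₀‖ := h1
      _ ≤ ‖arcModelIntegrand n r c φ₀‖ * (A + B) := by nlinarith
  · -- right of `1 + δ`: F6c × the `ζ`-bound
    -- here `cos θ > 0`, so `|θ| < π/2`
    have hx' := abs_le.1 hx
    have hcos_pos : 0 < Real.cos θ := by
      by_contra hc0
      push Not at hc0
      have : r * Real.cos θ ≤ 0 := mul_nonpos_of_nonneg_of_nonpos hr0.le hc0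
      linarith
    have hθ' : |θ| < Real.pi / 2 := by
      rcases hθ.lt_or_eq with hlt | heq
      · exact hlt
      · exfalso
        have : Real.cos θ = 0 := by
          rw [← Real.cos_abs, heq, Real.cos_pi_div_two]
        linarith
    have hF6 := norm_arcModelIntegrand_le_descent_R2_sub hx hT hℓ hn hh hhT hH hustar hS hθ'
    -- the arc point and the factorisation `arcIntegrandU = I · ζ`
    have hs_eq : (1 / 2 : ℂ) + circleMap c r θ =
        ((1 / 2 + x + r * Real.cos θ : ℝ) : ℂ) + ((T + r * Real.sin θ : ℝ) : ℂ) * I :=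
      half_add_circleMap_eq x T r θ
    have hgen : ∀ A B : ℝ, (((A : ℝ) : ℂ) + ((B : ℝ) : ℂ) * I).re = A := fun A B => by simp
    have hs_re : (1 / 2 + circleMap c r θ).re = 1 / 2 + x + r * Real.cos θ := by
      rw [hs_eq]; exact hgen _ _
    have hre_pos' : 0 < (1 / 2 + circleMap c r θ).re := by rw [hs_re]; linarith
    have hne1 : 1 / 2 + circleMap c r θ ≠ 1 := by
      intro h0
      have := congrArg Complex.re h0
      rw [hs_re] at this; simp at this; linarith
    rw [arcIntegrandU_eq_model_mul_zeta n r c θ hre_pos' hne1, norm_mul]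
    have hζ : ‖riemannZeta (1 / 2 + circleMap c r θ)‖ ≤ 1 + 1 / δ :=
      Zhang2022.ZetaNearOne.norm_riemannZeta_le_of_re hδ (by rw [hs_re]; linarith)
    -- the descent exponent: `1 − cos(θ − φ₀) ≥ 1 − cos ψ₁`
    have hφ₀1 : |φ₀| ≤ 1 := abs_saddle_arg_le_one hx hT hℓ hn hh hhT hustar hS
    have hdiff_le : |θ - φ₀| ≤ Real.pi := by
      have h1 : |θ - φ₀| ≤ |θ| + |φ₀| := abs_sub θ φ₀
      have hpi : (3 : ℝ) < Real.pi := Real.pi_gt_three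
      linarith
    have hcos_le : Real.cos (θ - φ₀) ≤ Real.cos ψ₁ := by
      rw [← Real.cos_abs (θ - φ₀)]
      exact Real.cos_le_cos_of_nonneg_of_le_pi hψ₁ hdiff_le hflank
    have hexp_le : Real.exp (-(((n : ℝ) + 1) * (1 - Real.cos (θ - φ₀)))) ≤
        Real.exp (-(((n : ℝ) + 1) * (1 - Real.cos ψ₁))) := by
      apply Real.exp_le_exp.2
      have hn0 : (0 : ℝ) ≤ (n : ℝ) + 1 := by positivity
      nlinarith
    have hζ0 : 0 ≤ ‖riemannZeta (1 / 2 + circleMap c r θ)‖ := norm_nonneg _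
    have hδ' : 0 ≤ 1 + 1 / δ := by have := one_div_pos.2 hδ; linarith
    calc ‖arcModelIntegrand n r c θ‖ * ‖riemannZeta (1 / 2 + circleMap c r θ)‖
        ≤ (Real.exp (12 * bandRadius n T + 6) * ‖arcModelIntegrand n r c φ₀‖ *
            Real.exp (-(((n : ℝ) + 1) * (1 - Real.cos (θ - φ₀))))) * (1 + 1 / δ) :=
          mul_le_mul hF6 hζ hζ0 (by positivity)
      _ ≤ (Real.exp (12 * bandRadius n T + 6) * ‖arcModelIntegrand n r c φ₀‖ *
            Real.exp (-(((n : ℝ) + 1) * (1 - Real.cos ψ₁)))) * (1 + 1 / δ) := by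
          apply mul_le_mul_of_nonneg_right _ hδ'
          exact mul_le_mul_of_nonneg_left hexp_le (by positivity)
      _ = ‖arcModelIntegrand n r c φ₀‖ * A := by rw [hA]; ring
      _ ≤ ‖arcModelIntegrand n r c φ₀‖ * (A + B) := by nlinarith

/-- **The saddle-circle estimate (S5-2b).** See the module docstring. [folklore] -/
theorem arc_integral_saddleCircle_estimate (hx : |x| ≤ 1 / 2) (hT : 100 ≤ T) (hℓ : 20 ≤ ell T)
    (hn : 100 ≤ n) (hh : 1 / 2 ≤ bandRadius n T) (hhT : bandRadius n T ≤ 7 / 20 * T)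
    (hH : bandRadius n T ≤ 20)
    (hustar : ‖ustar - ((x : ℂ) + (T : ℂ) * I + bandRadius n T)‖ ≤ 3 / 5 * bandRadius n T)
    (hS : arcSaddleFn n ((x : ℂ) + (T : ℂ) * I) ustar = 0) {ψ₁ δ : ℝ} (hψ₁ : 0 < ψ₁)
    (hψ₁s : ψ₁ ≤ 11 / 320)
    (hψ₁r : ‖ustar - ((x : ℂ) + (T : ℂ) * I)‖ * ψ₁ ≤ 1 / 20 * bandRadius n T) (hδ : 0 < δ)
    (hδ1 : δ ≤ 1)
    (hwin : 1 + δ + ‖ustar - ((x : ℂ) + (T : ℂ) * I)‖ * ψ₁ ≤ (1 / 2 + ustar).re) :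
    let c : ℂ := (x : ℂ) + (T : ℂ) * I
    let r : ℝ := ‖ustar - c‖
    let φ₀ : ℝ := Complex.arg (ustar - c)
    let w : ℂ := deriv (arcSaddleFn n c) ustar * (ustar - c) ^ 2 / 2
    let η : ℝ := r * ψ₁ / δ * Real.exp (r * ψ₁ / δ)
    let W : ℝ := 4 * (1 + η) * (4 * n) / w.re ^ 2 + η * Real.sqrt (π / w.re) +
      2 / (w.re * ψ₁) * Real.exp (-w.re * ψ₁ ^ 2)
    let F : ℝ := Real.exp (12 * bandRadius n T + 6) * (1 + 1 / δ) *
        Real.exp (-(((n : ℝ) + 1) * (1 - Real.cos ψ₁))) +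
      672 * Real.log (T + r) * Real.exp (2 * bandRadius n T + 1) *
        Real.exp (-(((1 / 2 + ustar).re - (1 + δ)) * (ell T / 2 - 1)))
    ‖(∫ θ in (-(π / 2))..(π / 2), arcIntegrandU n r c θ) -
        arcModelIntegrand n r c φ₀ * ((π : ℂ) / w) ^ (1 / 2 : ℂ) * riemannZeta (1 / 2 + ustar)‖ ≤
      ‖arcModelIntegrand n r c φ₀‖ * (‖riemannZeta (1 / 2 + ustar)‖ * W + π * F) := by
  intro c r φ₀ w η W F
  have hT0 : 0 < T := by linarith
  obtain ⟨hre_pos, -, -, -, hr_hi⟩ := arcSaddle_polar_bounds hx hT hℓ hn hh hhT hustar hS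
  have hw0 : ustar - c ≠ 0 := by
    intro h0
    have h' : (0 : ℝ) < (ustar - c).re := hre_pos
    rw [h0] at h'; simp at h'
  have hr0 : 0 < r := norm_pos_iff.2 hw0
  have hrψ : 0 ≤ r * ψ₁ := mul_nonneg hr0.le hψ₁.le
  have hδσ : 1 + δ ≤ (1 / 2 + ustar).re := by linarith
  -- `r < 2‖c‖` (so the arc integrand is continuous): `r ≤ (20/9)(n/ℓ) ≤ (10/9) h ≤ 0.39 T < 2T ≤ 2‖c‖`
  have hhℓ : bandRadius n T * ell T = 2 * ((n : ℝ) + 1) := bandRadius_mul_ell hℓ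
  have hℓ0 : 0 < ell T := by linarith
  have hr_le : r ≤ 10 / 9 * bandRadius n T := by
    have h1 : (n : ℝ) / ell T ≤ bandRadius n T / 2 := by
      rw [div_le_iff₀ hℓ0]; nlinarith
    have h2 : r ≤ 20 / 9 * ((n : ℝ) / ell T) := hr_hi
    linarith
  have hc_norm : T ≤ ‖c‖ := by
    have : c.im = T := by simp [c]
    rw [← this]; exact (le_abs_self _).trans (Complex.abs_im_le_norm c)
  have hr2 : r < 2 * ‖c‖ := by nlinarith
  have hcont : Continuous (arcIntegrandU n r c) := continuous_arcIntegrandU n hr0 hr2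
  -- the saddle angle: `|φ₀| ≤ 1`, so the window sits inside `(−π/2, π/2)`
  have hφ₀1 : |φ₀| ≤ 1 := abs_saddle_arg_le_one hx hT hℓ hn hh hhT hustar hS
  have hφ₀' := abs_le.1 hφ₀1
  have hpi : (3 : ℝ) < Real.pi := Real.pi_gt_three
  have hlo : -(π / 2) ≤ φ₀ - ψ₁ := by linarith
  have hhi : φ₀ + ψ₁ ≤ π / 2 := by linarith
  -- split the integral
  have hint : ∀ a b : ℝ, IntervalIntegrable (arcIntegrandU n r c) volume a b :=
    fun a b => hcont.intervalIntegrable a b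
  have hsplit : (∫ θ in (-(π / 2))..(π / 2), arcIntegrandU n r c θ) =
      (∫ θ in (-(π / 2))..(φ₀ - ψ₁), arcIntegrandU n r c θ) +
        (∫ θ in (φ₀ - ψ₁)..(φ₀ + ψ₁), arcIntegrandU n r c θ) +
        (∫ θ in (φ₀ + ψ₁)..(π / 2), arcIntegrandU n r c θ) := by
    rw [integral_add_adjacent_intervals (hint _ _) (hint _ _),
      integral_add_adjacent_intervals (hint _ _) (hint _ _)]
  -- the window, recentred
  have hwindow_eq : (∫ θ in (φ₀ - ψ₁)..(φ₀ + ψ₁), arcIntegrandU n r c θ) =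
      ∫ ψ in (-ψ₁)..ψ₁, arcIntegrandU n r c (φ₀ + ψ) := by
    have := intervalIntegral.integral_comp_add_left (arcIntegrandU n r c) φ₀ (a := -ψ₁) (b := ψ₁)
    rw [this, show φ₀ + -ψ₁ = φ₀ - ψ₁ by ring]
  have hwin := window_zeta_term hx hT hℓ hn hh hhT hustar hS hψ₁ hψ₁s hψ₁r hδ hwin
  -- pointwise flank bound
  have hflank_pt : ∀ θ : ℝ, |θ| ≤ π / 2 → ψ₁ ≤ |θ - φ₀| →
      ‖arcIntegrandU n r c θ‖ ≤ ‖arcModelIntegrand n r c φ₀‖ * F :=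
    fun θ hθ hfl => norm_arcIntegrandU_flank_le hx hT hℓ hn hh hhT hH hustar hS hδ hδ1 hδσ hψ₁.le
      hθ hfl
  -- left flank
  have hleft : ‖∫ θ in (-(π / 2))..(φ₀ - ψ₁), arcIntegrandU n r c θ‖ ≤
      ‖arcModelIntegrand n r c φ₀‖ * F * |φ₀ - ψ₁ - -(π / 2)| := by
    refine intervalIntegral.norm_integral_le_of_norm_le_const fun θ hθ => ?_
    rw [uIoc_of_le hlo] at hθ
    refine hflank_pt θ (abs_le.2 ⟨by linarith [hθ.1], by linarith [hθ.2]⟩) ?_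
    rw [abs_sub_comm, abs_of_nonneg (by linarith [hθ.2])]
    linarith [hθ.2]
  -- right flank
  have hright : ‖∫ θ in (φ₀ + ψ₁)..(π / 2), arcIntegrandU n r c θ‖ ≤
      ‖arcModelIntegrand n r c φ₀‖ * F * |π / 2 - (φ₀ + ψ₁)| := by
    refine intervalIntegral.norm_integral_le_of_norm_le_const fun θ hθ => ?_
    rw [uIoc_of_le hhi] at hθ
    refine hflank_pt θ (abs_le.2 ⟨by linarith [hθ.1], by linarith [hθ.2]⟩) ?_
    rw [abs_of_nonneg (by linarith [hθ.1])]
    linarith [hθ.1]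
  -- nonnegativity of `F`
  have hF0 : 0 ≤ F := by
    have : 0 ≤ 1 + 1 / δ := by have := one_div_pos.2 hδ; linarith
    have hlog0 : 0 ≤ Real.log (T + r) := Real.log_nonneg (by linarith)
    positivity
  have hI0 : 0 ≤ ‖arcModelIntegrand n r c φ₀‖ := norm_nonneg _
  -- assemble
  rw [hsplit, hwindow_eq]
  have htri : ‖(∫ θ in (-(π / 2))..(φ₀ - ψ₁), arcIntegrandU n r c θ) +
        (∫ ψ in (-ψ₁)..ψ₁, arcIntegrandU n r c (φ₀ + ψ)) +
        (∫ θ in (φ₀ + ψ₁)..(π / 2), arcIntegrandU n r c θ) -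
        arcModelIntegrand n r c φ₀ * ((π : ℂ) / w) ^ (1 / 2 : ℂ) * riemannZeta (1 / 2 + ustar)‖ ≤
      ‖∫ θ in (-(π / 2))..(φ₀ - ψ₁), arcIntegrandU n r c θ‖ +
        ‖(∫ ψ in (-ψ₁)..ψ₁, arcIntegrandU n r c (φ₀ + ψ)) -
          arcModelIntegrand n r c φ₀ * ((π : ℂ) / w) ^ (1 / 2 : ℂ) * riemannZeta (1 / 2 + ustar)‖ +
        ‖∫ θ in (φ₀ + ψ₁)..(π / 2), arcIntegrandU n r c θ‖ := by
    set P := ∫ θ in (-(π / 2))..(φ₀ - ψ₁), arcIntegrandU n r c θ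
    set Q := ∫ ψ in (-ψ₁)..ψ₁, arcIntegrandU n r c (φ₀ + ψ)
    set R := ∫ θ in (φ₀ + ψ₁)..(π / 2), arcIntegrandU n r c θ
    set M := arcModelIntegrand n r c φ₀ * ((π : ℂ) / w) ^ (1 / 2 : ℂ) * riemannZeta (1 / 2 + ustar)
    calc ‖P + Q + R - M‖ = ‖P + (Q - M) + R‖ := by ring_nf
      _ ≤ ‖P + (Q - M)‖ + ‖R‖ := norm_add_le _ _
      _ ≤ ‖P‖ + ‖Q - M‖ + ‖R‖ := by linarith [norm_add_le P (Q - M)]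
  refine htri.trans ?_
  have hlen : |φ₀ - ψ₁ - -(π / 2)| + |π / 2 - (φ₀ + ψ₁)| ≤ π := by
    rw [abs_of_nonneg (by linarith), abs_of_nonneg (by linarith)]; linarith
  have hflanks : ‖∫ θ in (-(π / 2))..(φ₀ - ψ₁), arcIntegrandU n r c θ‖ +
      ‖∫ θ in (φ₀ + ψ₁)..(π / 2), arcIntegrandU n r c θ‖ ≤
      ‖arcModelIntegrand n r c φ₀‖ * (π * F) := by
    have h1 := add_le_add hleft hright
    have h2 : ‖arcModelIntegrand n r c φ₀‖ * F * |φ₀ - ψ₁ - -(π / 2)| +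
        ‖arcModelIntegrand n r c φ₀‖ * F * |π / 2 - (φ₀ + ψ₁)| ≤
        ‖arcModelIntegrand n r c φ₀‖ * (π * F) := by
      have := mul_le_mul_of_nonneg_left hlen (mul_nonneg hI0 hF0)
      linarith [this]
    exact h1.trans h2
  have hwin' : ‖(∫ ψ in (-ψ₁)..ψ₁, arcIntegrandU n r c (φ₀ + ψ)) -
      arcModelIntegrand n r c φ₀ * ((π : ℂ) / w) ^ (1 / 2 : ℂ) * riemannZeta (1 / 2 + ustar)‖ ≤
      ‖arcModelIntegrand n r c φ₀‖ * (‖riemannZeta (1 / 2 + ustar)‖ * W) := by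
    have := hwin
    simp only at this
    calc _ ≤ ‖arcModelIntegrand n r c φ₀‖ * ‖riemannZeta (1 / 2 + ustar)‖ * W := this
      _ = _ := by ring
  linarith [hflanks, hwin']

end Summit.RiemannHypothesis.RiemannHypothesis.Theorems.JensenPolynomials.LogBandArc

end
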